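import Mathlib.Analysis.SpecialFunctions.Gaussian.PoissonSummation
import Mathlib.NumberTheory.ModularForms.JacobiTheta.Bounds
import HarnessLib

/-!
# Crux `BirComplexStableXYR`, line `fat-gaussian-defect-calculus`: stub E7 `stub_thetaPositive`

Registered stub (lead c8, wave 8, skeleton `Cruxes/BirComplexStableXYR/Lines/fat_gaussian_defect_calculus.lean`),
helper (`--supports`) for the crux `Summit.HubbardSuperconductivity.HubbardSuperconductivity.Theses.BalabanIR.BirComplexStableXYR`:
**the tilted theta series is a positive real number.**

**Statement.** For real `E > 0` and real `α`, the tilted theta series `Σ_{h ∈ ℤ} exp(−E h² + iαh)` is summable,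
its sum has positive real part and zero imaginary part.  (At the Gaussian level this is the vortex-free part of the
partition function, `E = 2π²Kρ_t L²/M`, `α = 2πKL²μ`.)

**Proof.** Pure Mathlib.  Poisson summation for the Gaussian, `Complex.tsum_exp_neg_quadratic` with `a = E/π`
(`re a = E/π > 0`) and `b = iα/(2π)`, reads `Σ_n exp(−E n² + iαn) = a^{-1/2} · Σ_n exp(−(π/a)(n + ib)²)`; here
`n + ib = n − α/(2π)` is real, so every summand on the right is the real number `exp(−(π²/E)(n − α/(2π))²) > 0` and the
prefactor is the real number `1/(E/π)^{1/2} > 0` (`Complex.ofReal_cpow`).  Hence the sum is the cast of a positive real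
(`Complex.ofReal_tsum`, `Summable.tsum_pos`; summability of the shifted integer Gaussian is
`HurwitzKernelBounds.summable_f_int 0`).  Summability of the series itself: its terms have norm `exp(−E h²)`
(`Complex.norm_exp`), again an integer Gaussian.  Elementary given Mathlib; no definition and no named fact is
introduced; sorry-free. [folklore]
-/

set_option linter.dupNamespace false -- `Summit.<S>.<S>.Theorems…` repeats the summit name (D-0017 layout)

namespace Summit.HubbardSuperconductivity.HubbardSuperconductivity.Theorems.FSUnfolding

open Complex Real

/-- **Poisson side, left:** with `a = E/π` and `b = iα/(2π)` the summand `exp(−πan² + 2πbn)` of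
`Complex.tsum_exp_neg_quadratic` is the tilted theta summand `exp(−E n² + iαn)` (casts pushed, `π ≠ 0`).
[folklore] -/
theorem hsc_thetaPos_lhs_term (E α : ℝ) (n : ℤ) :
    Complex.exp (-π * ((E / π : ℝ) : ℂ) * n ^ 2 + 2 * π * (I * ((α / (2 * π) : ℝ) : ℂ)) * n) =
      Complex.exp (-((E * (n : ℝ) ^ 2 : ℝ) : ℂ) + Complex.I * ((α * (n : ℝ) : ℝ) : ℂ)) := by
  congr 1
  have hπ : (π : ℂ) ≠ 0 := ofReal_ne_zero.mpr Real.pi_ne_zero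
  push_cast
  field_simp

/-- **Poisson side, right:** with `a = E/π`, `b = iα/(2π)` the dual summand `exp(−(π/a)(n + ib)²)` is the cast of
the real Gaussian `exp(−(π²/E)(n − α/(2π))²)` (`i·i = −1`, so `n + ib` is real). [folklore] -/
theorem hsc_thetaPos_rhs_term (E α : ℝ) (hE : 0 < E) (n : ℤ) :
    Complex.exp (-π / ((E / π : ℝ) : ℂ) * (n + I * (I * ((α / (2 * π) : ℝ) : ℂ))) ^ 2) =
      ((Real.exp (-(π ^ 2 / E * ((n : ℝ) - α / (2 * π)) ^ 2)) : ℝ) : ℂ) := by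
  rw [Complex.ofReal_exp]
  congr 1
  have hπ : (π : ℂ) ≠ 0 := ofReal_ne_zero.mpr Real.pi_ne_zero
  have hE' : (E : ℂ) ≠ 0 := ofReal_ne_zero.mpr hE.ne'
  push_cast
  have : (n : ℂ) + I * (I * (α / (2 * π))) = n - α / (2 * π) := by
    rw [← mul_assoc, I_mul_I]; ring
  rw [this]
  field_simp

/-- **Poisson prefactor is real:** `1 / (E/π)^{1/2}` computed in `ℂ` (principal branch) is the cast of the real
number `1 / (E/π)^{1/2}` since `E/π ≥ 0` (`Complex.ofReal_cpow`). [folklore] -/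
theorem hsc_thetaPos_prefactor (E : ℝ) (hE : 0 < E) :
    (1 : ℂ) / ((E / π : ℝ) : ℂ) ^ (1 / 2 : ℂ) = (((1 : ℝ) / (E / π) ^ (1 / 2 : ℝ) : ℝ) : ℂ) := by
  have h : 0 ≤ E / π := by positivity
  rw [ofReal_div _ ((E / π) ^ (1 / 2 : ℝ)), ofReal_one, ofReal_cpow h]
  norm_num

/-- **Shifted integer Gaussians are summable:** `Σ_{n ∈ ℤ} exp(−(π²/E)(n − α/(2π))²) < ∞` for `E > 0`
(Mathlib's `HurwitzKernelBounds.summable_f_int` with `k = 0`, shift `−α/(2π)`, `t = π/E`). [folklore] -/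
theorem hsc_thetaPos_gauss_summable (E α : ℝ) (hE : 0 < E) :
    Summable (fun n : ℤ => Real.exp (-(π ^ 2 / E * ((n : ℝ) - α / (2 * π)) ^ 2))) := by
  have := HurwitzKernelBounds.summable_f_int 0 (-(α / (2 * π))) (by positivity : 0 < π / E)
  refine this.congr (fun n => ?_)
  simp only [HurwitzKernelBounds.f_int, pow_zero, one_mul]
  congr 1
  field_simp
  ring

/-- **Norm of the tilted theta summand:** `‖exp(−E n² + iαn)‖ = exp(−E n²)` (`Complex.norm_exp`: the tilt `iαn`
is purely imaginary). [folklore] -/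
theorem hsc_thetaPos_norm_term (E α : ℝ) (n : ℤ) :
    ‖Complex.exp (-((E * (n : ℝ) ^ 2 : ℝ) : ℂ) + Complex.I * ((α * (n : ℝ) : ℝ) : ℂ))‖ =
      Real.exp (-(E * (n : ℝ) ^ 2)) := by
  rw [Complex.norm_exp, Complex.add_re, Complex.neg_re, Complex.ofReal_re, Complex.I_mul_re,
    Complex.ofReal_im, neg_zero, add_zero]

/-- **The tilted theta series is absolutely summable:** its norms form the integer Gaussian `exp(−E n²)`, summable
for `E > 0` (`HurwitzKernelBounds.summable_f_int` with `k = 0`, no shift, `t = E/π`). [folklore] -/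
theorem hsc_thetaPos_lhs_summable (E α : ℝ) (hE : 0 < E) :
    Summable (fun h : ℤ => Complex.exp (-((E * (h : ℝ) ^ 2 : ℝ) : ℂ) +
      Complex.I * ((α * (h : ℝ) : ℝ) : ℂ))) := by
  refine Summable.of_norm ?_
  simp_rw [hsc_thetaPos_norm_term]
  have := HurwitzKernelBounds.summable_f_int 0 0 (by positivity : 0 < E / π)
  refine this.congr (fun n => ?_)
  simp only [HurwitzKernelBounds.f_int, pow_zero, one_mul, add_zero]
  congr 1
  field_simp

/-- **stub E7 (S): the tilted theta series is positive (Poisson summation / charge representation).**  For `E > 0` and real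
`α`, `Σ_{h∈ℤ} e^{−Eh² + iαh} = √(π/E)·Σ_{m∈ℤ} e^{−(π²/E)(m − α/(2π))²}` is a POSITIVE real number (Mathlib
`Complex.tsum_exp_neg_quadratic` with `a = E/π`, `b = iα/(2π)`): the series is summable, the real part of its sum is
positive and the imaginary part vanishes.  This is the Gaussian-level positivity of the vortex-free sum in every regime
of `E = 2π²Kρ_tL²/M`. [folklore] -/
theorem stub_thetaPositive :
    ∀ (E α : ℝ), 0 < E →
      Summable (fun h : ℤ => Complex.exp (-((E * (h : ℝ) ^ 2 : ℝ) : ℂ) + Complex.I * ((α * (h : ℝ) : ℝ) : ℂ))) ∧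
      0 < (∑' h : ℤ, Complex.exp (-((E * (h : ℝ) ^ 2 : ℝ) : ℂ) + Complex.I * ((α * (h : ℝ) : ℝ) : ℂ))).re ∧
      (∑' h : ℤ, Complex.exp (-((E * (h : ℝ) ^ 2 : ℝ) : ℂ) + Complex.I * ((α * (h : ℝ) : ℝ) : ℂ))).im = 0 := by
  intro E α hE
  have ha : 0 < (((E / π : ℝ) : ℂ)).re := by rw [ofReal_re]; positivity
  have hS := hsc_thetaPos_gauss_summable E α hE
  -- Poisson summation, with both sides rewritten: the sum is the cast of a real number.
  have key : (∑' h : ℤ, Complex.exp (-((E * (h : ℝ) ^ 2 : ℝ) : ℂ) + Complex.I * ((α * (h : ℝ) : ℝ) : ℂ))) =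
      (((1 : ℝ) / (E / π) ^ (1 / 2 : ℝ) *
        ∑' n : ℤ, Real.exp (-(π ^ 2 / E * ((n : ℝ) - α / (2 * π)) ^ 2)) : ℝ) : ℂ) := by
    calc (∑' h : ℤ, Complex.exp (-((E * (h : ℝ) ^ 2 : ℝ) : ℂ) + Complex.I * ((α * (h : ℝ) : ℝ) : ℂ)))
        = ∑' n : ℤ, Complex.exp (-π * ((E / π : ℝ) : ℂ) * n ^ 2 +
            2 * π * (I * ((α / (2 * π) : ℝ) : ℂ)) * n) :=
          tsum_congr (fun n => (hsc_thetaPos_lhs_term E α n).symm)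
      _ = 1 / ((E / π : ℝ) : ℂ) ^ (1 / 2 : ℂ) *
            ∑' n : ℤ, Complex.exp (-π / ((E / π : ℝ) : ℂ) * (n + I * (I * ((α / (2 * π) : ℝ) : ℂ))) ^ 2) :=
          Complex.tsum_exp_neg_quadratic ha _
      _ = (((1 : ℝ) / (E / π) ^ (1 / 2 : ℝ) : ℝ) : ℂ) *
            ∑' n : ℤ, ((Real.exp (-(π ^ 2 / E * ((n : ℝ) - α / (2 * π)) ^ 2)) : ℝ) : ℂ) := by
          rw [hsc_thetaPos_prefactor E hE, tsum_congr (hsc_thetaPos_rhs_term E α hE)]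
      _ = _ := by rw [← ofReal_tsum, ← ofReal_mul]
  refine ⟨hsc_thetaPos_lhs_summable E α hE, ?_, ?_⟩
  · -- real part: positive prefactor times a sum of positive reals
    rw [key, ofReal_re]
    refine mul_pos (by positivity) ?_
    exact hS.tsum_pos (fun n => (Real.exp_pos _).le) 0 (Real.exp_pos _)
  · -- imaginary part of a real cast
    rw [key, ofReal_im]

end Summit.HubbardSuperconductivity.HubbardSuperconductivity.Theorems.FSUnfolding
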